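import Summits.Ventures.HSemireg.EmbeddedFirstOrderDeformationsCechMinusOneCurve

/-!
# Venture HSemireg — the lift of the `(−1)`-curve is UNIQUE (`H⁰(ℙ¹, 𝒪(−1)) = 0`): the Čech `0`-cocycles of the
# normal data of the `(−1)`-atlas vanish, so the torsor of `…CechObstruction` is a point

HONEST FRAMING.  Lean side of the computation cell `pub-hsemireg` (track «S4-PUSH» (ii), seat s4-prove-3 g6, second
route for (S5)); log `s4push/prove-3/ATTEMPT-10.md` §5h.  Companion of `…CechMinusOneCurve` (existence): by
`…CechObstruction`'s torsor theorem (Thm. 6.2 (b), last sentence) lifts differ by compatible families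
`ψ_α ∈ Hom(I_α, A_α/I_α)` (`ψ₀|_{01} = ψ₁|_{01}`, i.e. `Ȟ⁰(Z, 𝒩)` of the cover); for the `(−1)`-atlas every such
family is ZERO (a polynomial `a(s)` equal to `s⁻¹·b(s⁻¹)` in `k[s, s⁻¹]` vanishes, and so does `b`), hence the
lift of `…CechMinusOneCurve` is the ONLY one.  Plain commutative algebra; no Mathlib scheme, sheaf, abelian variety or
semiregularity map; nothing here says that HC, HC_CM or HC_AV holds; no object is certified; no Literature fact.

WHAT (namespace `Summit.Ventures.HSemireg.EmbeddedDeformation.DoubledLine`):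
* §1 `spec a = a(s, 0) ∈ k[x]`, `iota : k[x] → k[s,p]`, `sub_iota_spec_mem : a − ι(a(s,0)) ∈ (p)` (induction on `a`),
  `mk_eq_zero_of_spec_eq_zero`, and `LinearMap` extensionality on the principal ideal `(p) ⊂ k[s,p]`.
* §2 `eq_zero_of_laurent_identity`: in `k[x]_x`, `x·a(x) = b(x⁻¹)` forces `a = b = 0` (clear denominators with
  `x^N`, `Polynomial.reflect`, compare degrees).
* §3 **`compatible_eq_zero_minusOne`** — `Ȟ⁰ = 0`: every compatible family `ψ` for the `(−1)`-atlas is `0`;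
  §4 **`isAtlasLift_minusOne_unique`** — any two lifts of the zero section of `𝒪_{ℙ¹}(−1)` to the deformation
  `q = sp + εs` are EQUAL (with `exists_isAtlasLift_minusOne`: it lifts uniquely — the `(−1)`-curve is rigid).

References: R. Hartshorne, *Deformation Theory*, GTM 257 (2010), §6 Thm. 6.2 (b) and Ex. 6.2.2 [corpus:
book:springernd-deformation-theory p0054]; `H⁰(ℙ¹, 𝒪(−1)) = 0` [folklore].
-/

namespace Summit.Ventures.HSemireg

namespace EmbeddedDeformation

namespace DoubledLine

open DualNumber TrivSqZeroExt MvPolynomial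

universe u

variable (k : Type u) [CommRing k]

/-! ### §1 `a ≡ a(s,0) (mod p)` and extensionality on `(p)` -/

/-- `a ↦ a(s, 0) ∈ k[x]` (set `p = 0`, rename `s ↦ x`). -/
noncomputable abbrev spec : A k →+* Polynomial k := MvPolynomial.eval₂Hom Polynomial.C ![Polynomial.X, 0]

/-- `k[x] → k[s,p]`, `x ↦ s`. -/
noncomputable abbrev iota : Polynomial k →+* A k := Polynomial.eval₂RingHom MvPolynomial.C (X 0)

/-- `a − ι(a(s,0)) ∈ (p)`: a polynomial agrees with its `p = 0` specialisation modulo `p`. [folklore] -/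
theorem sub_iota_spec_mem (α : Fin 2) (a : A k) : a - iota k (spec k a) ∈ idealZ k α := by
  induction a using MvPolynomial.induction_on with
  | C c =>
    have : iota k (spec k (C c)) = C c := by
      rw [MvPolynomial.eval₂Hom_C, Polynomial.coe_eval₂RingHom, Polynomial.eval₂_C]
    rw [this, sub_self]
    exact Ideal.zero_mem _
  | add p q hp hq =>
    have : p + q - iota k (spec k (p + q)) = (p - iota k (spec k p)) + (q - iota k (spec k q)) := by
      rw [map_add, map_add]; ring
    rw [this]
    exact Ideal.add_mem _ hp hq
  | mul_X p i hp =>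
    fin_cases i
    · have : p * X 0 - iota k (spec k (p * X 0)) = (p - iota k (spec k p)) * X 0 := by
        rw [map_mul, map_mul, MvPolynomial.eval₂Hom_X', Matrix.cons_val_zero, Polynomial.coe_eval₂RingHom,
          Polynomial.eval₂_X]
        ring
      show p * X 0 - iota k (spec k (p * X 0)) ∈ idealZ k α
      rw [this]
      exact Ideal.mul_mem_right _ _ hp
    · have : p * X 1 - iota k (spec k (p * X 1)) = p * X 1 := by
        rw [map_mul, MvPolynomial.eval₂Hom_X', Matrix.cons_val_one, Matrix.cons_val_fin_one, mul_zero, map_zero,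
          sub_zero]
      show p * X 1 - iota k (spec k (p * X 1)) ∈ idealZ k α
      rw [this]
      exact Ideal.mul_mem_left _ _ (Ideal.subset_span rfl)

/-- If `a(s,0) = 0` then `a ≡ 0 (mod p)`. [folklore] -/
theorem mk_eq_zero_of_spec_eq_zero (α : Fin 2) {a : A k} (h : spec k a = 0) :
    Ideal.Quotient.mk (idealZ k α) a = 0 := by
  rw [Ideal.Quotient.eq_zero_iff_mem]
  have := sub_iota_spec_mem k α a
  rwa [h, map_zero, sub_zero] at this

/-- Two `A`-linear maps on `(p) ⊂ k[s,p]` that agree on `p` are equal. [folklore] -/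
theorem ext_of_X_one {α : Fin 2} {N : Type*} [AddCommGroup N] [Module (A k) N] {f g : idealZ k α →ₗ[A k] N}
    (hmem : (X 1 : A k) ∈ idealZ k α) (h : f ⟨X 1, hmem⟩ = g ⟨X 1, hmem⟩) : f = g := by
  refine LinearMap.ext fun x ↦ ?_
  obtain ⟨x, hx⟩ := x
  obtain ⟨c, rfl⟩ := Ideal.mem_span_singleton'.1 hx
  have e : (⟨c * X 1, hx⟩ : idealZ k α) = c • (⟨X 1, hmem⟩ : idealZ k α) :=
    Subtype.ext (by rw [Submodule.coe_smul, smul_eq_mul])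
  rw [e, map_smul, map_smul, h]

/-! ### §2 The Laurent identity `x·a(x) = b(x⁻¹)` forces `a = b = 0` -/

/-- In `k[x]_x` with `u·x = 1`: if `x·a(x) = b(u)` then `a = 0` and `b = 0` (multiply by `x^N`, `N = deg b`:
`x^{N+1}·a = x^N·b(x⁻¹) = reflect N b` in `k[x]`, of degree `≤ N` — so `a = 0`, then `b = 0`). [folklore] -/
theorem eq_zero_of_laurent_identity (a b : Polynomial k) {u : Localization.Away (Polynomial.X : Polynomial k)}
    (hu : u * algebraMap (Polynomial k) (Localization.Away (Polynomial.X : Polynomial k)) Polynomial.X = 1)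
    (h : algebraMap (Polynomial k) (Localization.Away (Polynomial.X : Polynomial k)) Polynomial.X *
        algebraMap (Polynomial k) _ a = Polynomial.eval₂ (algebraMap k _) u b) : a = 0 ∧ b = 0 := by
  set x : Localization.Away (Polynomial.X : Polynomial k) :=
    algebraMap (Polynomial k) (Localization.Away (Polynomial.X : Polynomial k)) Polynomial.X with hx
  haveI : Invertible x := ⟨u, hu, by rw [mul_comm]; exact hu⟩
  have hux : ⅟x = u := invOf_eq_left_inv hu
  have hrr : Polynomial.reflect b.natDegree (Polynomial.reflect b.natDegree b) = b :=
    Polynomial.ext fun i ↦ by rw [Polynomial.coeff_reflect, Polynomial.coeff_reflect, Polynomial.revAt_invol]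
  have hdeg : (Polynomial.reflect b.natDegree b).natDegree ≤ b.natDegree :=
    Polynomial.natDegree_le_iff_coeff_eq_zero.2 fun i hi ↦ by
      rw [Polynomial.coeff_reflect, Polynomial.revAt_eq_self_of_lt hi]
      exact Polynomial.coeff_eq_zero_of_natDegree_lt hi
  have hev : ∀ q : Polynomial k,
      Polynomial.eval₂ (algebraMap k (Localization.Away (Polynomial.X : Polynomial k))) x q =
        algebraMap (Polynomial k) (Localization.Away (Polynomial.X : Polynomial k)) q := by
    intro q
    have e : Polynomial.eval₂RingHom (algebraMap k (Localization.Away (Polynomial.X : Polynomial k))) x =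
        algebraMap (Polynomial k) (Localization.Away (Polynomial.X : Polynomial k)) :=
      Polynomial.ringHom_ext (fun c ↦ by
          rw [Polynomial.coe_eval₂RingHom, Polynomial.eval₂_C, IsScalarTower.algebraMap_apply k (Polynomial k)
            (Localization.Away (Polynomial.X : Polynomial k)) c, Polynomial.algebraMap_eq])
        (by rw [Polynomial.coe_eval₂RingHom, Polynomial.eval₂_X])
    exact DFunLike.congr_fun e q
  have h1 : Polynomial.eval₂ (algebraMap k _) u b * x ^ b.natDegree =
      algebraMap (Polynomial k) _ (Polynomial.reflect b.natDegree b) := by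
    have := Polynomial.eval₂_reflect_mul_pow (algebraMap k (Localization.Away (Polynomial.X : Polynomial k))) x
      b.natDegree (Polynomial.reflect b.natDegree b) hdeg
    rw [hrr, hux, hev] at this
    exact this
  -- `x^{N+1}·a = reflect N b` in `k[x]`
  have h3 : algebraMap (Polynomial k) (Localization.Away (Polynomial.X : Polynomial k))
      (a * Polynomial.X ^ (b.natDegree + 1)) = algebraMap (Polynomial k) _ (Polynomial.reflect b.natDegree b) := by
    rw [← h1, ← h, map_mul, map_pow, ← hx]
    ring
  have hinj : Function.Injective (algebraMap (Polynomial k) (Localization.Away (Polynomial.X : Polynomial k))) :=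
    IsLocalization.injective _ (Submonoid.powers_le.2 (mem_nonZeroDivisors_iff_right.2 fun q hq ↦
      (Polynomial.isRegular_X (R := k)).right (show q * Polynomial.X = 0 * Polynomial.X by rw [hq, zero_mul])))
  have h4 : a * Polynomial.X ^ (b.natDegree + 1) = Polynomial.reflect b.natDegree b := hinj h3
  have ha : a = 0 := by
    rcases subsingleton_or_nontrivial k with hk | hk
    · exact Polynomial.ext fun i ↦ Subsingleton.elim _ _
    · by_contra ha
      have hd := congrArg Polynomial.natDegree h4
      rw [Polynomial.natDegree_mul_X_pow (b.natDegree + 1) ha] at hd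
      omega
  refine ⟨ha, ?_⟩
  rw [ha, zero_mul] at h4
  rw [← hrr, ← h4, Polynomial.reflect_zero]

/-! ### §3 `Ȟ⁰ = 0` for the `(−1)`-atlas -/

/-- `ev ∘ psi1₀ : k[s,p] → k[x]_x` is `s ↦ x⁻¹, p ↦ 0`. [folklore] -/
theorem ev_comp_psi1₀ :
    (ev k).comp (psi1₀ k) =
      MvPolynomial.eval₂Hom (algebraMap k (Localization.Away (Polynomial.X : Polynomial k)))
        ![ev k (IsLocalization.Away.invSelf (X 0 : A k)), 0] := by
  refine MvPolynomial.ringHom_ext (fun c ↦ ?_) (fun i ↦ ?_)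
  · rw [RingHom.comp_apply, psi1₀_C, ev_algebraMap_eq, MvPolynomial.eval₂Hom_C, MvPolynomial.eval₂_C,
      IsScalarTower.algebraMap_apply k (Polynomial k) (Localization.Away (Polynomial.X : Polynomial k)) c,
      Polynomial.algebraMap_eq]
  · fin_cases i
    · simp [psi1₀_X_zero]
    · simp [psi1₀_X_one, ev_algebraMap_X_one]

/-- **`Ȟ⁰(Z, 𝒩) = 0` for the `(−1)`-atlas**: a compatible family `ψ_α ∈ Hom(I_α, A_α/I_α)` (`ψ₀|_{αβ} = ψ_β|_{αβ}`,
restrictions along the chart maps of `𝒪_{ℙ¹}(−1)`, for any base local lifts `T_α`) is ZERO.  At the generator: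
`ψ₀(p) = a`, `ψ₁(q) = b` give `s·a(s,p) ≡ psi1(b) (mod p)`, i.e. `x·a(x,0) = b(x⁻¹, 0)` in `k[x]_x`
(`eq_zero_of_laurent_identity`), so `a(s,0) = b(t,0) = 0`, `ψ_α(generator) = 0`, `ψ = 0`.
[cite: Hartshorne2010, §6 Thm. 6.2 (b), Ex. 6.2.2] -/
theorem compatible_eq_zero_minusOne {T : ∀ α : Fin 2, Ideal (A k)[ε]}
    (hT : ∀ α, IsLift (fstRingHom (A k)) (ε : (A k)[ε]) (idealZ k α) (T α))
    (ψ : ∀ α : Fin 2, idealZ k α →ₗ[A k] A k ⧸ idealZ k α)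
    (hψ : ∀ α β, resL (thickenedAtlas_minusOne k) hT α β (ψ α) = resR (thickenedAtlas_minusOne k) hT α β (ψ β)) :
    ψ = 0 := by
  have 𝔄 := thickenedAtlas_minusOne k
  have hX1 : (X 1 : A k) ∈ idealZ k 0 := Ideal.subset_span rfl
  have hX1' : (X 1 : A k) ∈ idealZ k 1 := Ideal.subset_span rfl
  have hmem : algebraMap (A k) (L k) (X 1) ∈ idealZ₂ k 0 1 := Ideal.mem_map_of_mem _ (Ideal.subset_span rfl)
  have hmem₁ : resM1 k 1 (X 1) ∈ idealZ₂ k 0 1 := by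
    rw [resM1_one_X_one]
    exact Ideal.mul_mem_left _ _ hmem
  obtain ⟨a, ha⟩ := Ideal.Quotient.mk_surjective (ψ 0 ⟨X 1, hX1⟩)
  obtain ⟨b, hb⟩ := Ideal.Quotient.mk_surjective (ψ 1 ⟨X 1, hX1'⟩)
  have e0 : resL (thickenedAtlas_minusOne k) hT 0 1 (ψ 0) ⟨algebraMap (A k) (L k) (X 1), hmem⟩ =
      Ideal.Quotient.mk (idealZ₂ k 0 1) (algebraMap (A k) (L k) a) :=
    resNormal_apply (𝔄.homl 0 1) (𝔄.liftsl 0 1) (hT 0) (ψ 0) ⟨X 1, hX1⟩ a ha hmem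
  have e1 : resR (thickenedAtlas_minusOne k) hT 0 1 (ψ 1) ⟨resM1 k 1 (X 1), hmem₁⟩ =
      Ideal.Quotient.mk (idealZ₂ k 0 1) (resM1 k 1 b) :=
    resNormal_apply (𝔄.homr 0 1) (𝔄.liftsr 0 1) (hT 1) (ψ 1) ⟨X 1, hX1'⟩ b hb hmem₁
  have hx1 : (⟨resM1 k 1 (X 1), hmem₁⟩ : idealZ₂ k 0 1) =
      algebraMap (A k) (L k) (X 0) • (⟨algebraMap (A k) (L k) (X 1), hmem⟩ : idealZ₂ k 0 1) :=
    Subtype.ext (by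
      show resM1 k 1 (X 1) = algebraMap (A k) (L k) (X 0) • algebraMap (A k) (L k) (X 1)
      rw [resM1_one_X_one, smul_eq_mul])
  rw [hx1, ← hψ 0 1, map_smul, e0] at e1
  -- `s·a ≡ psi1(b) (mod (p)·L)`; evaluate in `k[x]_x`
  have hsm : ∀ c z : L k, c • Ideal.Quotient.mk (idealZ₂ k 0 1) z = Ideal.Quotient.mk (idealZ₂ k 0 1) (c * z) :=
    fun _ _ ↦ rfl
  rw [hsm, Ideal.Quotient.eq] at e1
  have hev := ev_eq_zero_of_mem k e1
  rw [map_sub, map_mul, ev_algebraMap_X_zero, ev_algebraMap_eq k a, resM1_one_apply, psi1Hom_algebraMap,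
    ← RingHom.comp_apply (ev k) (psi1₀ k), ev_comp_psi1₀, eval₂Hom_pair_zero, sub_eq_zero] at hev
  have hinv : ev k (IsLocalization.Away.invSelf (X 0 : A k)) *
      algebraMap (Polynomial k) (Localization.Away (Polynomial.X : Polynomial k)) Polynomial.X = 1 := by
    rw [← ev_algebraMap_X_zero, ← map_mul, mul_comm, IsLocalization.Away.mul_invSelf, map_one]
  obtain ⟨ha0, hb0⟩ := eq_zero_of_laurent_identity k _ _ hinv hev
  -- `ψ_α (generator) = 0`, hence `ψ = 0`
  have h0 : ψ 0 = 0 := ext_of_X_one k hX1 (by rw [ha.symm, LinearMap.zero_apply, mk_eq_zero_of_spec_eq_zero k 0 ha0])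
  have h1 : ψ 1 = 0 :=
    ext_of_X_one k hX1' (by rw [hb.symm, LinearMap.zero_apply, mk_eq_zero_of_spec_eq_zero k 1 hb0])
  funext α
  fin_cases α
  · exact h0
  · exact h1

/-! ### §4 Rigidity: the lift of the `(−1)`-curve is unique -/

/-- **THE (−1)-CURVE LIFTS UNIQUELY.**  Any two lifts `K, K'` of the zero section of `𝒪_{ℙ¹}(−1)` to the deformation
`q = sp + εs` coincide: their difference is a compatible family (`…CechObstruction`, `IsAtlasLift.diff_cocycle`),
which vanishes (`compatible_eq_zero_minusOne`), so `K' = K` (`IsAtlasLift.eq_of_diff_eq_zero`).  With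
`exists_isAtlasLift_minusOne`: existence AND uniqueness (`H¹(𝒪(−1)) = H⁰(𝒪(−1)) = 0`).
[cite: Hartshorne2010, §6 Thm. 6.2 (b), Ex. 6.2.2] -/
theorem isAtlasLift_minusOne_unique {K K' : Fin 2 → Ideal (A k)[ε]}
    (hK : IsAtlasLift (fun _ : Fin 2 ↦ fstRingHom (A k)) (fun _ ↦ (ε : (A k)[ε])) (fun α _ ↦ mapRingHom (resM1 k α))
      (fun α β ↦ (twist (thetaFamily k α β) : (L k)[ε] →+* (L k)[ε]).comp (mapRingHom (resM1 k β))) (idealZ k) K)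
    (hK' : IsAtlasLift (fun _ : Fin 2 ↦ fstRingHom (A k)) (fun _ ↦ (ε : (A k)[ε])) (fun α _ ↦ mapRingHom (resM1 k α))
      (fun α β ↦ (twist (thetaFamily k α β) : (L k)[ε] →+* (L k)[ε]).comp (mapRingHom (resM1 k β))) (idealZ k) K') :
    K' = K :=
  hK.eq_of_diff_eq_zero (thickenedAtlas_minusOne k) hK' fun α ↦
    congr_fun (compatible_eq_zero_minusOne k hK.isLift _ (hK.diff_cocycle (thickenedAtlas_minusOne k) hK.isLift hK'))
      α

end DoubledLine

end EmbeddedDeformation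

end Summit.Ventures.HSemireg
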